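import Summits.NavierStokesRegularity.NavierStokesRegularity.Theorems.TypeILiouvilleTypeIliouvilleNoTypeIIGradientPivot
import Summits.NavierStokesRegularity.NavierStokesRegularity.Theorems.TypeILiouvilleTypeIliouvilleNoTypeIIStubThreeFifthsLawCurl
import Literature.Analysis.FluidPDE.ElgindiBlowup
import HarnessLib

/-!
# `TypeIliouvilleNoTypeII` (stmt-NavierStokesRegularity-0056) ⇔ VorticityBKMSharp ∧ WindowTypeI′ —
# the vorticity form of the glue of the line `Sketch` (gradient-bkm-pivot), sorry-free

Companion of `TypeILiouvilleTypeIliouvilleNoTypeIIGradientPivot` (p139883: `NoTypeII ⇔ A ∧ B` with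
A = GradientBKMSharp `‖∇u(t)‖_∞ ≤ C/(T-t)`, B = WindowTypeI).  BKM-sharpness is canonically a
statement about the VORTICITY, `‖curl u(t)‖_∞ ≤ C/(T - t)` (Beale–Kato–Majda; the quantity
reported by the near-singular numerics, Hou arXiv:2107.06509 §3.4).  Over the landed vorticity
form of the kinematic 3/5 law (`stub_threeFifthsLawCurl`, p139422:
`‖v‖_∞ ≤ C ‖v‖₂^{2/5} ‖curl v‖_∞^{3/5}` for smooth divergence-free finite-energy `v`) the same
split works at the vorticity rate:

* `velocityThreeFifths_of_vorticitySharp` — `‖curl u(t)‖_∞ ≤ C₁/(T-t)` near `T` already gives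
  `‖u(t)‖_∞ ≤ C₂/(T-t)^{3/5}` near `T`;
* `vorticitySharp_of_noTypeII` — the crux implies **VorticityBKMSharp** (A′) (from the landed
  `gradientSharp_of_noTypeII` and `‖curl v(x)‖ ≤ 4‖Dv(x)‖`, `norm_curl_le_four_mul`);
* `TypeIliouvilleNoTypeII_iff_vorticitySharp` = registered composition stub
  `stub_noTypeII_iff_vorticitySharp_and_windowTypeI` — **`NoTypeII ⇔ A′ ∧ B′`**, B′ = "a
  vorticity-sharp solution of the class obeying the 3/5 velocity bound is Type I".  A′ is weaker
  than A (A ⇒ A′ pointwise; A′ ⇒ A only up to a logarithm, Calderón–Zygmund), B′ correspondingly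
  stronger than B; both are open, and each is necessary for the crux.
-/

noncomputable section

-- the summit and its single problem share the name `NavierStokesRegularity` (D-0017 nested layout)
set_option linter.dupNamespace false

open Set Function Filter Topology MeasureTheory Metric
open scoped NNReal ENNReal

namespace Summit.NavierStokesRegularity.NavierStokesRegularity.Theorems.TypeIliouvilleNoTypeII.GradientPivot

open Literature.Analysis Literature.Analysis.FluidPDE

/-- `ℝ³`. -/
local notation "E3" => EuclideanSpace ℝ (Fin 3)

/-! ## The vorticity form

BKM-sharpness is canonically a statement about the VORTICITY, `‖curl u(t)‖_∞ ≤ C/(T - t)`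
(Beale–Kato–Majda; the quantity reported by the near-singular numerics, Hou arXiv:2107.06509 §3.4,
Kerr).  The vorticity form of the 3/5 law makes the same split work with this weaker residual
`VorticityBKMSharp` (A′) in place of `GradientBKMSharp` (A ⇒ A′ by `‖curl v‖ ≤ 4‖Dv‖`; A′ ⇒ A
only up to a logarithm, by Calderón–Zygmund), at the price of the correspondingly stronger window
statement B′. -/

/-- **The 3/5 velocity bound under vorticity sharpness** (STUBS 6 + 3): `‖curl u(t)‖_∞ ≤ C₁/(T-t)`
near `T` already implies `‖u(t)‖_∞ ≤ C₂/(T-t)^{3/5}` near `T`. [folklore] -/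
theorem velocityThreeFifths_of_vorticitySharp {ν T : ℝ} (hν : 0 < ν) (hT : 0 < T)
    {u : ℝ → E3 → E3} {p : ℝ → E3 → ℝ}
    (hsol : IsClassicalNSSolutionOn (Ico 0 T) ν 0 u p) (hLH : IsLerayHopfOn T ν 0 (u 0) u)
    (hΩ : ∃ C₁ : ℝ, ∀ᶠ t in 𝓝[<] T, ∀ x, ‖curl (u t) x‖ ≤ C₁ / (T - t)) :
    ∃ C₂ : ℝ, ∀ᶠ t in 𝓝[<] T, ∀ x, ‖u t x‖ ≤ C₂ / (T - t) ^ (3 / 5 : ℝ) := by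
  obtain ⟨C, hC, h35⟩ := stub_threeFifthsLawCurl
  obtain ⟨C₁, hC₁⟩ := hΩ
  have hE := stub_energyBound ν T hν u hLH
  set E₀ : ℝ := ∫ y, ‖u 0 y‖ ^ 2 with hE₀
  refine ⟨C * E₀ ^ (1 / 5 : ℝ) * (max C₁ 0) ^ (3 / 5 : ℝ), ?_⟩
  filter_upwards [hC₁, Ico_mem_nhdsLT hT] with t ht htI x
  have hTt : 0 < T - t := sub_pos.2 htI.2
  set L : ℝ := max C₁ 0 / (T - t) with hL
  have hL0 : 0 ≤ L := div_nonneg (le_max_right _ _) hTt.le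
  have hcurl : ∀ y, ‖curl (u t) y‖ ≤ L := fun y =>
    (ht y).trans (div_le_div_of_nonneg_right (le_max_left _ _) hTt.le)
  have hsm : ContDiff ℝ (⊤ : ℕ∞) (u t) := hsol.contDiff_velocity htI
  obtain ⟨hmem, hle⟩ := hE t (Ico_subset_Icc_self htI)
  have key := h35 (u t) L hsm (hsol.divFree t htI) hmem hL0 hcurl x
  have hEt0 : 0 ≤ ∫ y, ‖u t y‖ ^ 2 := integral_nonneg fun y => by positivity
  have h1 : (∫ y, ‖u t y‖ ^ 2) ^ (1 / 5 : ℝ) ≤ E₀ ^ (1 / 5 : ℝ) :=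
    Real.rpow_le_rpow hEt0 hle (by norm_num)
  have h2 : L ^ (3 / 5 : ℝ) = (max C₁ 0) ^ (3 / 5 : ℝ) / (T - t) ^ (3 / 5 : ℝ) := by
    rw [hL, Real.div_rpow (le_max_right _ _) hTt.le]
  calc ‖u t x‖ ≤ C * (∫ y, ‖u t y‖ ^ 2) ^ (1 / 5 : ℝ) * L ^ (3 / 5 : ℝ) := key
    _ ≤ C * E₀ ^ (1 / 5 : ℝ) * L ^ (3 / 5 : ℝ) := by
        gcongr
    _ = C * E₀ ^ (1 / 5 : ℝ) * (max C₁ 0) ^ (3 / 5 : ℝ) / (T - t) ^ (3 / 5 : ℝ) := by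
        rw [h2]; ring

/-- **Vorticity sharpness is necessary**: the crux implies `VorticityBKMSharp` (A′) —
`‖curl u(t)‖_∞ ≤ C/(T - t)` near `T` for every maximal Leray–Hopf solution from a rapidly decaying
datum (`gradientSharp_of_noTypeII` and `‖curl v x‖ ≤ 4 ‖Dv(x)‖`, `norm_curl_le_four_mul`). [folklore] -/
theorem vorticitySharp_of_noTypeII
    (h : Summit.NavierStokesRegularity.NavierStokesRegularity.Theses.TypeILiouville.TypeIliouvilleNoTypeII)
    (ν T : ℝ) (hν : 0 < ν) (hT : 0 < T) (u : ℝ → E3 → E3) (p : ℝ → E3 → ℝ)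
    (hmax : IsMaximalSmoothSolution ν 0 u p T) (hLH : IsLerayHopfOn T ν 0 (u 0) u)
    (hdec : HasRapidSpatialDecay (u 0)) :
    ∃ C : ℝ, ∀ᶠ t in 𝓝[<] T, ∀ x, ‖curl (u t) x‖ ≤ C / (T - t) := by
  obtain ⟨C, hC⟩ := gradientSharp_of_noTypeII h ν T hν hT u p hmax hLH hdec
  refine ⟨4 * C, ?_⟩
  filter_upwards [hC] with t ht x
  calc ‖curl (u t) x‖ ≤ 4 * ‖fderiv ℝ (u t) x‖ := norm_curl_le_four_mul (u t) x
    _ ≤ 4 * (C / (T - t)) := by gcongr; exact ht x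
    _ = 4 * C / (T - t) := by ring

/-- **`NoTypeII ⇔ VorticityBKMSharp ∧ WindowTypeI′`** — the split of the line at the VORTICITY
rate: (A′) every maximal Leray–Hopf solution from a rapidly decaying datum has
`‖curl u(t)‖_∞ ≤ C/(T - t)` near `T` (BKM-sharp vorticity; necessary, `vorticitySharp_of_noTypeII`),
and (B′) such a solution which is vorticity-sharp and obeys the 3/5 velocity bound (automatic,
`velocityThreeFifths_of_vorticitySharp`) is Type I.  Both A′ and B′ are open; A′ is weaker than
the gradient residual A of `TypeIliouvilleNoTypeII_iff`, B′ correspondingly stronger than B. [folklore] -/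
theorem TypeIliouvilleNoTypeII_iff_vorticitySharp :
    Summit.NavierStokesRegularity.NavierStokesRegularity.Theses.TypeILiouville.TypeIliouvilleNoTypeII ↔
      ((∀ (ν T : ℝ), 0 < ν → 0 < T → ∀ (u : ℝ → E3 → E3) (p : ℝ → E3 → ℝ),
          IsMaximalSmoothSolution ν 0 u p T → IsLerayHopfOn T ν 0 (u 0) u →
          HasRapidSpatialDecay (u 0) →
          ∃ C : ℝ, ∀ᶠ t in 𝓝[<] T, ∀ x, ‖curl (u t) x‖ ≤ C / (T - t)) ∧
        (∀ (ν T : ℝ), 0 < ν → 0 < T → ∀ (u : ℝ → E3 → E3) (p : ℝ → E3 → ℝ),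
          IsMaximalSmoothSolution ν 0 u p T → IsLerayHopfOn T ν 0 (u 0) u →
          HasRapidSpatialDecay (u 0) →
          (∃ C₁ : ℝ, ∀ᶠ t in 𝓝[<] T, ∀ x, ‖curl (u t) x‖ ≤ C₁ / (T - t)) →
          (∃ C₂ : ℝ, ∀ᶠ t in 𝓝[<] T, ∀ x, ‖u t x‖ ≤ C₂ / (T - t) ^ (3 / 5 : ℝ)) →
          IsTypeIBlowup u T)) := by
  constructor
  · intro h
    exact ⟨vorticitySharp_of_noTypeII h, fun ν T hν hT u p hmax hLH hdec _ _ =>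
      h ν T hν hT u p hmax hLH hdec⟩
  · rintro ⟨hA, hB⟩ ν T hν hT u p hmax hLH hdec
    have hΩ := hA ν T hν hT u p hmax hLH hdec
    exact hB ν T hν hT u p hmax hLH hdec hΩ (velocityThreeFifths_of_vorticitySharp hν hT hmax.1 hLH hΩ)

/-- **Registered composition stub (vorticity form)** of the line `Sketch` (gradient-bkm-pivot),
crux `TypeIliouvilleNoTypeII` (stmt-NavierStokesRegularity-0056): `NoTypeII ⇔ VorticityBKMSharp ∧ WindowTypeI′`
(= `TypeIliouvilleNoTypeII_iff_vorticitySharp`). [folklore] -/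
theorem stub_noTypeII_iff_vorticitySharp_and_windowTypeI :
    Summit.NavierStokesRegularity.NavierStokesRegularity.Theses.TypeILiouville.TypeIliouvilleNoTypeII ↔
      ((∀ (ν T : ℝ), 0 < ν → 0 < T → ∀ (u : ℝ → E3 → E3) (p : ℝ → E3 → ℝ),
          IsMaximalSmoothSolution ν 0 u p T → IsLerayHopfOn T ν 0 (u 0) u →
          HasRapidSpatialDecay (u 0) →
          ∃ C : ℝ, ∀ᶠ t in 𝓝[<] T, ∀ x, ‖curl (u t) x‖ ≤ C / (T - t)) ∧
        (∀ (ν T : ℝ), 0 < ν → 0 < T → ∀ (u : ℝ → E3 → E3) (p : ℝ → E3 → ℝ),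
          IsMaximalSmoothSolution ν 0 u p T → IsLerayHopfOn T ν 0 (u 0) u →
          HasRapidSpatialDecay (u 0) →
          (∃ C₁ : ℝ, ∀ᶠ t in 𝓝[<] T, ∀ x, ‖curl (u t) x‖ ≤ C₁ / (T - t)) →
          (∃ C₂ : ℝ, ∀ᶠ t in 𝓝[<] T, ∀ x, ‖u t x‖ ≤ C₂ / (T - t) ^ (3 / 5 : ℝ)) →
          IsTypeIBlowup u T)) :=
  TypeIliouvilleNoTypeII_iff_vorticitySharp

end Summit.NavierStokesRegularity.NavierStokesRegularity.Theorems.TypeIliouvilleNoTypeII.GradientPivot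

end
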